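import Summits.NavierStokesRegularity.FluidComputer.PalasekTowerRegisterGlobalHeredity
import Summits.NavierStokesRegularity.FluidComputer.PalasekTowerRegisterGlobalDesignSlot

/-!
# REGISTER v2.3′: what the ∀-schedule first episode (`HeredityAt 0`) asks of every level-`0` host

Cell `ns-blowup`, seat `ns-blowup-ecbridge-4` (g0); companion of `PalasekTowerRegisterGlobalHeredity.lean`
(p415576: `HeredityAt k`, the constructor `Stage.nonempty_extends_of_continuation`),
`PalasekTowerRegisterGlobalFirstHitting.lean` (p417307: the anchor's bite, `Stage.first_jump`) and
`PalasekTowerRegisterGlobalDesign{,Slot}.lean` (the design-class split `FirstEpisodeD D`, the `c₄ = 0`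
silence). The BC3 birth skeleton of the crux `EpisodeBaseG` (item stmt-NavierStokesRegularity-19179,
route `PalasekTowerBreakdown`) had the stub `first_episode` = `HeredityAt 0`; by planner RULING STATUS
l.1890 this ∀-schedule form is a NAMED TRAP, not a filing shape (the filing shape is `FirstEpisodeD`
over a named design class). LABEL: E–C typing (KERNEL bookkeeping). WHAT THIS IS NOT: not
Navier–Stokes evidence — nothing is inhabited or asserted; `HeredityAt 0` appears only as a hypothesis
or inside an `↔`.

* `heredityAt_iff_exists_continuation k` — the LOSSLESS `(u, p)`-unfolding of heredity at any level
  (converse direction `Stage.exists_continuation_of_extends`); `heredityAt_zero_iff`.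
* `HeredityAt.first_episode_demand` — what the ∀-stub claims of EVERY registered host: a continuation
  under the schedule's own force that DOUBLES the global speed maximum (exactly `c₁ Y₀` at `τ₀`,
  `≥ c₁ Y₁ ≥ 2 c₁ Y₀` in the ball at `τ₁ = τ₀ + c₅ log N₁ / A₀`), force impulse `≤ (c₁ Y₁ − c₂ Y₀)/8`.
* `HeredityAt.silent_first_episode` — on the `c₄ = 0` schedules the stub is UNFORCED level-0 heredity
  (the trap in the kernel); `HeredityAt.firstEpisodeD` — the ∀-stub implies the first episode over
  every design class (push := the schedule's own force and constant).

References: S. Palasek, arXiv:2605.13827 §3.3, §4 and Rem. 1.4 [cite: Palasek2026ElementaryModel, §4].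
-/

noncomputable section

namespace Summit.NavierStokesRegularity.FluidComputer.PalasekTowerClayBridge

open Set MeasureTheory Filter Topology Function Real
open scoped ENNReal ContDiff NNReal InnerProductSpace RealInnerProductSpace
open Literature.Analysis.FluidPDE

/-- **Heredity at level `k`, unfolded losslessly into `(u, p)`-data**: `HeredityAt k` holds iff for
every pinned rigid quiet schedule and every globally anchored registered stage at level `k` there is
a classical continuation `(u, p)` on `[0, τ (k+1)]` with the schedule's force, agreeing with the stage
on `[0, τ k]`, of finite energy, inside the ceiling `c₂ Y_{k+1}`, and meeting at `τ (k+1)` the speed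
floor `c₁ Y_{k+1}`, the strain floor `c₁ A_{k+1}` and the level-`(k+1)` core ledger — the seven
inputs of `Stage.nonempty_extends_of_continuation` (rigidity discharges the new quiet clause, the
global anchor is inherited), with converse `Stage.exists_continuation_of_extends`. [folklore] -/
theorem heredityAt_iff_exists_continuation (k : ℕ) :
    HeredityAt k ↔
      ∀ S : Schedule TowerRates.wide, S.Pins 8 (6 / 5) → S.Rigid → S.Quiet →
        ∀ s : Stage 1 TowerRates.wide S (Margins.routeG TowerRates.wide) k,
        ∃ (u : ℝ → EuclideanSpace ℝ (Fin 3) → EuclideanSpace ℝ (Fin 3))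
          (p : ℝ → EuclideanSpace ℝ (Fin 3) → ℝ),
          IsClassicalNSSolutionOn (Icc 0 (S.τ (k + 1))) 1 S.f u p ∧
          (∀ t ∈ Icc 0 (S.τ k), u t = s.u t ∧ p t = s.p t) ∧
          (∃ C : ℝ≥0∞, C < ⊤ ∧ ∀ t ∈ Icc 0 (S.τ (k + 1)), ∫⁻ x, ‖u t x‖ₑ ^ 2 ≤ C) ∧
          (∀ t ∈ Icc 0 (S.τ (k + 1)), ∀ x, ‖u t x‖ ≤ S.c₂ * TowerRates.wide.Y (k + 1)) ∧
          (∃ x, ‖x‖ ≤ S.radius ∧ S.c₁ * TowerRates.wide.Y (k + 1) ≤ ‖u (S.τ (k + 1)) x‖) ∧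
          (∃ x, ‖x‖ ≤ S.radius ∧
            S.c₁ * TowerRates.wide.A (k + 1) ≤ ‖fderiv ℝ (u (S.τ (k + 1))) x‖) ∧
          (∃ (x : EuclideanSpace ℝ (Fin 3)) (γ : ℝ → EuclideanSpace ℝ (Fin 3)),
            ‖x‖ ≤ S.radius ∧ ContDiff ℝ 1 γ ∧ γ 0 = γ 1 ∧
            (∀ σ ∈ Icc (0 : ℝ) 1, γ σ ∈ Metric.closedBall x (1 / TowerRates.wide.N (k + 1))) ∧
            (∀ σ ∈ Icc (0 : ℝ) 1, ‖deriv γ σ‖ ≤ 8 * π / TowerRates.wide.N (k + 1)) ∧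
            S.c₁ * TowerRates.wide.N (k + 1) ^ (TowerRates.wide.β - 2) ≤
              circulation (u (S.τ (k + 1))) γ) := by
  constructor
  · intro h S hP hR hQ s
    obtain ⟨s', hs'⟩ := h S hP hR hQ s
    exact s.exists_continuation_of_extends s' hs'
  · intro h S hP hR hQ s
    obtain ⟨u, p, hcl, hagree, henergy, hceil, hfloor, hstrain, hcore⟩ := h S hP hR hQ s
    exact s.nonempty_extends_of_continuation hR hcl hagree henergy hceil hfloor hstrain hcore

/-- **The first episode, unfolded** (`k = 0` of `heredityAt_iff_exists_continuation`): `HeredityAt 0`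
holds iff every globally anchored registered level-`0` stage of every pinned rigid quiet schedule on
the wide-base rates has a classical finite-energy continuation to `τ₁` inside the ceiling `c₂ Y₁`
meeting at `τ₁` the speed floor `c₁ Y₁`, the strain floor `c₁ A₁` and the level-`1` core ledger.
[cite: Palasek2026ElementaryModel, §4] -/
theorem heredityAt_zero_iff :
    HeredityAt 0 ↔
      ∀ S : Schedule TowerRates.wide, S.Pins 8 (6 / 5) → S.Rigid → S.Quiet →
        ∀ s : Stage 1 TowerRates.wide S (Margins.routeG TowerRates.wide) 0,
        ∃ (u : ℝ → EuclideanSpace ℝ (Fin 3) → EuclideanSpace ℝ (Fin 3))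
          (p : ℝ → EuclideanSpace ℝ (Fin 3) → ℝ),
          IsClassicalNSSolutionOn (Icc 0 (S.τ 1)) 1 S.f u p ∧
          (∀ t ∈ Icc 0 (S.τ 0), u t = s.u t ∧ p t = s.p t) ∧
          (∃ C : ℝ≥0∞, C < ⊤ ∧ ∀ t ∈ Icc 0 (S.τ 1), ∫⁻ x, ‖u t x‖ₑ ^ 2 ≤ C) ∧
          (∀ t ∈ Icc 0 (S.τ 1), ∀ x, ‖u t x‖ ≤ S.c₂ * TowerRates.wide.Y 1) ∧
          (∃ x, ‖x‖ ≤ S.radius ∧ S.c₁ * TowerRates.wide.Y 1 ≤ ‖u (S.τ 1) x‖) ∧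
          (∃ x, ‖x‖ ≤ S.radius ∧
            S.c₁ * TowerRates.wide.A 1 ≤ ‖fderiv ℝ (u (S.τ 1)) x‖) ∧
          (∃ (x : EuclideanSpace ℝ (Fin 3)) (γ : ℝ → EuclideanSpace ℝ (Fin 3)),
            ‖x‖ ≤ S.radius ∧ ContDiff ℝ 1 γ ∧ γ 0 = γ 1 ∧
            (∀ σ ∈ Icc (0 : ℝ) 1, γ σ ∈ Metric.closedBall x (1 / TowerRates.wide.N 1)) ∧
            (∀ σ ∈ Icc (0 : ℝ) 1, ‖deriv γ σ‖ ≤ 8 * π / TowerRates.wide.N 1) ∧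
            S.c₁ * TowerRates.wide.N 1 ^ (TowerRates.wide.β - 2) ≤
              circulation (u (S.τ 1)) γ) := by
  have h := heredityAt_iff_exists_continuation 0
  simp only [zero_add] at h
  exact h

/-- **What `first_episode` demands of EVERY admissible host.** Under `HeredityAt 0`, every globally
anchored registered level-`0` stage `s` of a pinned rigid quiet schedule — i.e. every host prepared by
a FREE push on `[0, τ₀)` and read out at the first hitting time `τ₀` of the speed `c₁ Y₀` — continues
classically under the schedule's force (of size `≤ c₄ Y₀` on the window) to
`τ₁ = τ₀ + c₅ log N₁ / A₀`, and the continuation DOUBLES the global speed maximum: `‖u (τ₀, ·)‖ ≤ c₁ Y₀`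
everywhere, `‖u (τ₁, x)‖ ≥ c₁ Y₁ ≥ 2 c₁ Y₀` at some point of the ball, the admissible force impulse on
the window being `≤ (c₁ Y₁ − c₂ Y₀)/8` (`Stage.first_jump`). The level-`0` heredity is thus asserted
for every un-earned host at once; no instance is claimed here. [cite: Palasek2026ElementaryModel, §4] -/
theorem HeredityAt.first_episode_demand (h : HeredityAt 0) {S : Schedule TowerRates.wide}
    (hP : S.Pins 8 (6 / 5)) (hR : S.Rigid) (hQ : S.Quiet)
    (s : Stage 1 TowerRates.wide S (Margins.routeG TowerRates.wide) 0) :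
    ∃ s' : Stage 1 TowerRates.wide S (Margins.routeG TowerRates.wide) 1, s.Extends s' ∧
      (∀ y, ‖s'.u (S.τ 0) y‖ ≤ S.c₁ * TowerRates.wide.Y 0) ∧
      (∃ x, ‖x‖ ≤ S.radius ∧ S.c₁ * TowerRates.wide.Y 1 ≤ ‖s'.u (S.τ 1) x‖) ∧
      2 * (S.c₁ * TowerRates.wide.Y 0) ≤ S.c₁ * TowerRates.wide.Y 1 ∧
      S.τ 1 - S.τ 0 = S.c₅ * Real.log (TowerRates.wide.N 1) / TowerRates.wide.A 0 ∧
      8 * (S.c₄ * TowerRates.wide.Y 0) * (S.τ 1 - S.τ 0) ≤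
        S.c₁ * TowerRates.wide.Y 1 - S.c₂ * TowerRates.wide.Y 0 := by
  obtain ⟨s', hs'⟩ := h S hP hR hQ s
  exact ⟨s', hs', Stage.first_jump (k := 0) hP s'⟩


/-- **On the `c₄ = 0` schedules the stub `first_episode` is UNFORCED level-`0` heredity**: under
`HeredityAt 0`, every globally anchored registered level-`0` stage of a pinned rigid quiet schedule
with push constant `c₄ = 0` extends to level `1` although the schedule's force vanishes identically
from `τ₀` on — the autonomous first compaction (`Re₀ = N₀^{β-2} ≈ 5.3`) that the route does not bet
on (planner OBJECTION, STATUS l.1832; the same holds for any re-forcing at fixed `c₄`, by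
`Schedule.admissible_eq_zero_of_c₄_eq_zero`). [cite: Palasek2026ElementaryModel, §4 and Rem. 1.4] -/
theorem HeredityAt.silent_first_episode (h : HeredityAt 0) {S : Schedule TowerRates.wide}
    (hP : S.Pins 8 (6 / 5)) (hR : S.Rigid) (hQ : S.Quiet) (h4 : S.c₄ = 0)
    (s : Stage 1 TowerRates.wide S (Margins.routeG TowerRates.wide) 0) :
    (∀ t, S.τ 0 ≤ t → ∀ x, S.f t x = 0) ∧
      ∃ s' : Stage 1 TowerRates.wide S (Margins.routeG TowerRates.wide) 1, s.Extends s' :=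
  ⟨fun _ ht x => S.force_eq_zero_of_c₄_eq_zero h4 ht x, h S hP hR hQ s⟩

/-- **The ∀-schedule stub implies the first episode over EVERY design class** (push constant and push
:= the schedule's own; re-pushing a schedule by its own data is the same schedule, by structure eta) —
so `HeredityAt 0` sits above the whole `FirstEpisodeD` family, `FirstEpisodeAll` included. [folklore] -/
theorem HeredityAt.firstEpisodeD (h : HeredityAt 0) (D : HostClass) : FirstEpisodeD D := by
  intro S hP hR hQ s₀ _
  obtain ⟨s₁, hs₁⟩ := h S hP hR hQ s₀
  exact ⟨S.c₄, S.c₄_le, S.f, S.force_smooth, S.force_decay, S.force_silent, S.push_small,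
    fun t _ x => rfl, hP, hR, hQ, s₁, hs₁⟩

end Summit.NavierStokesRegularity.FluidComputer.PalasekTowerClayBridge

end
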